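import Summits.Ventures.HodgeRepro.Night3CensusDistinct

/-!
# The sealed representatives are pairwise inequivalent in the `(G, c)` model: exactly `reps.length` twist classes

Blind re-derivation cell `pub-hodge-repro`, seat `night-3` (gen 3).  Imports night-3's `Night3CensusDistinct`
(`repsDistinct`, decided for the eleven sealed rows) and, through it, `Night3CensusBridge` (`cornersMul`, `twistSort`,
`sortNat_perm`, `exists_finsetOf`).  Namespace `HodgeRepro.Night3.Census`.

`cornersMul_ne_twistMul_of_repsDistinct` reads `repsDistinct Γ reps = true` in the model: for two different positions
`a ≠ b` of `reps` (all of them faces of the engine) and every `g`, the corner multiset of `reps[a]` is NOT the twist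
`(cornersMul Γ reps[b])·g`.  Together with `cover_of_coversFaces` this says that the faces of the row fall into EXACTLY
`reps.length` Galois-twist classes of corner multisets, represented by the sealed list without repetition — the
hypothesis `hreps` of `alg_of_reps` has no redundant member.  Ingredients: masks below `2 ^ n` are determined by their
finsets (`finsetOf_inj_of_lt`), the engine's corners of a face are such masks (`corners_lt`), and the engine's insertion
sort is Mathlib's (`sortNat_eq_insertionSort`), so two sorted corner lists of permuted corner lists coincide
(`sortNat_eq_of_perm`).  Nothing here closes S4; no sealed file is touched; no Tier-2 item depends on this file.
-/

set_option autoImplicit false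

namespace HodgeRepro.Night3.Census

open Summit.Ventures.HodgeRepro.FaceCensus
open HodgeRepro.EngineBridge

variable {n : ℕ}

/-! ### The engine's insertion sort is Mathlib's -/

/-- `insertNat` is `List.orderedInsert (· ≤ ·)`. -/
theorem insertNat_eq_orderedInsert (a : ℕ) (l : List ℕ) : insertNat a l = List.orderedInsert (· ≤ ·) a l := by
  induction l with
  | nil => rfl
  | cons b l ih =>
    show (if a ≤ b then a :: b :: l else b :: insertNat a l) = List.orderedInsert (· ≤ ·) a (b :: l)
    rw [List.orderedInsert, ih]

/-- `sortNat` is `List.insertionSort (· ≤ ·)`. -/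
theorem sortNat_eq_insertionSort (l : List ℕ) : sortNat l = List.insertionSort (· ≤ ·) l := by
  induction l with
  | nil => rfl
  | cons a l ih =>
    show insertNat a (sortNat l) = List.insertionSort (· ≤ ·) (a :: l)
    rw [ih, insertNat_eq_orderedInsert]
    rfl

/-- `sortNat l` is sorted. -/
theorem sortNat_pairwise (l : List ℕ) : List.Pairwise (· ≤ ·) (sortNat l) := by
  rw [sortNat_eq_insertionSort]
  exact List.pairwise_insertionSort _ _

/-- Permuted lists have the same `sortNat`. -/
theorem sortNat_eq_of_perm {l₁ l₂ : List ℕ} (h : List.Perm l₁ l₂) : sortNat l₁ = sortNat l₂ :=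
  List.Perm.eq_of_pairwise' (sortNat_pairwise l₁) (sortNat_pairwise l₂)
    ((sortNat_perm l₁).trans (h.trans (sortNat_perm l₂).symm))

/-! ### Masks below `2 ^ n` -/

/-- Two masks below `2 ^ n` with the same finset are equal. -/
theorem finsetOf_inj_of_lt (Γ : CMGaloisType n) {T T' : ℕ} (hT : T < 2 ^ n) (hT' : T' < 2 ^ n)
    (h : finsetOf Γ T = finsetOf Γ T') : T = T' := by
  apply Nat.eq_of_testBit_eq
  intro i
  by_cases hi : i < n
  · have := congrArg (fun S => Elt.ofIdx Γ ⟨i, hi⟩ ∈ S) h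
    simp only [mem_finsetOf, mem_eq, Elt.idx_ofIdx, eq_iff_iff] at this
    exact Bool.eq_iff_iff.mpr this
  · have hi' : n ≤ i := Nat.le_of_not_lt hi
    rw [Nat.testBit_lt_two_pow (lt_of_lt_of_le hT (Nat.pow_le_pow_right (by norm_num) hi')),
      Nat.testBit_lt_two_pow (lt_of_lt_of_le hT' (Nat.pow_le_pow_right (by norm_num) hi'))]

/-- A mask of a finset (classically chosen; `exists_finsetOf`). -/
noncomputable def maskOf (Γ : CMGaloisType n) (Φ : Finset (Elt Γ)) : ℕ :=
  Classical.choose (exists_finsetOf Γ Φ)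

/-- `maskOf Φ < 2 ^ n`. -/
theorem maskOf_lt (Γ : CMGaloisType n) (Φ : Finset (Elt Γ)) : maskOf Γ Φ < 2 ^ n :=
  (Classical.choose_spec (exists_finsetOf Γ Φ)).1

/-- `finsetOf (maskOf Φ) = Φ`. -/
theorem finsetOf_maskOf (Γ : CMGaloisType n) (Φ : Finset (Elt Γ)) : finsetOf Γ (maskOf Γ Φ) = Φ :=
  (Classical.choose_spec (exists_finsetOf Γ Φ)).2

/-- `maskOf (finsetOf T) = T` for `T < 2 ^ n`. -/
theorem maskOf_finsetOf_of_lt (Γ : CMGaloisType n) {T : ℕ} (hT : T < 2 ^ n) : maskOf Γ (finsetOf Γ T) = T :=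
  finsetOf_inj_of_lt Γ (maskOf_lt Γ _) hT (finsetOf_maskOf Γ _)

/-- A list of masks below `2 ^ n` is recovered from its finsets. -/
theorem map_maskOf_map_finsetOf (Γ : CMGaloisType n) {l : List ℕ} (hl : ∀ x ∈ l, x < 2 ^ n) :
    (l.map (finsetOf Γ)).map (maskOf Γ) = l := by
  rw [List.map_map]
  exact (List.map_congr_left fun x hx => maskOf_finsetOf_of_lt Γ (hl x hx)).trans (List.map_id l)

/-! ### The engine's masks are below `2 ^ n` -/

/-- `bit i < 2 ^ n`. -/
theorem bit_lt (i : Fin n) : bit i < 2 ^ n :=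
  Nat.pow_lt_pow_right (by norm_num) i.isLt

/-- `imageMask f T < 2 ^ n`. -/
theorem imageMask_lt (f : Fin n → Fin n) (T : ℕ) : imageMask f T < 2 ^ n := by
  unfold imageMask
  suffices H : ∀ (l : List (Fin n)) (acc : ℕ), acc < 2 ^ n →
      l.foldl (fun acc i => if mem i T then acc ||| bit (f i) else acc) acc < 2 ^ n from
    H _ 0 (by positivity)
  intro l
  induction l with
  | nil => intro acc h; simpa using h
  | cons a l ih =>
    intro acc h
    simp only [List.foldl_cons]
    apply ih
    split_ifs
    · exact Nat.or_lt_two_pow h (bit_lt _)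
    · exact h

/-- `placeMask i < 2 ^ n`. -/
theorem placeMask_lt (Γ : CMGaloisType n) (i : Fin n) : Γ.placeMask i < 2 ^ n :=
  Nat.or_lt_two_pow (bit_lt _) (bit_lt _)

/-- `flipAt π T < 2 ^ n` for `π, T < 2 ^ n` (the engine's flip, `T ^^^ π`). -/
theorem flipAt_lt {π T : ℕ} (hπ : π < 2 ^ n) (hT : T < 2 ^ n) :
    Summit.Ventures.HodgeRepro.FaceCensus.flipAt π T < 2 ^ n :=
  Nat.xor_lt_two_pow hT hπ

/-- The corners of a face with masks below `2 ^ n` are below `2 ^ n`. -/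
theorem corners_lt (Γ : CMGaloisType n) {T π π' : ℕ} (hT : T < 2 ^ n) (hπ : π < 2 ^ n) (hπ' : π' < 2 ^ n) :
    ∀ x ∈ Γ.corners (T, π, π'), x < 2 ^ n := by
  intro x hx
  simp only [CMGaloisType.corners, List.mem_cons, List.not_mem_nil, or_false] at hx
  rcases hx with rfl | rfl | rfl | rfl
  · exact hT
  · exact flipAt_lt hπ (imageMask_lt _ _)
  · exact flipAt_lt hπ' (imageMask_lt _ _)
  · exact flipAt_lt hπ' (flipAt_lt hπ hT)

/-- The masks of an engine face are below `2 ^ n`. -/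
theorem mem_faces_lt (Γ : CMGaloisType n) {f : ℕ × ℕ × ℕ} (hf : f ∈ Γ.faces) :
    f.1 < 2 ^ n ∧ f.2.1 < 2 ^ n ∧ f.2.2 < 2 ^ n := by
  unfold CMGaloisType.faces at hf
  rw [List.mem_flatMap] at hf
  obtain ⟨T, hT, hf⟩ := hf
  rw [List.mem_flatMap] at hf
  obtain ⟨p, hp, hf⟩ := hf
  rw [List.mem_map] at hf
  obtain ⟨q, hq, rfl⟩ := hf
  rw [List.mem_filter] at hq
  have hT' : T < 2 ^ n := by
    unfold CMGaloisType.cmTypes at hT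
    rw [List.mem_filter, List.mem_range] at hT
    exact hT.1
  have hplace : ∀ x ∈ Γ.places, x < 2 ^ n := by
    intro x hx
    change x ∈ normalize ((List.finRange n).map Γ.placeMask) at hx
    rw [mem_normalize, List.mem_map] at hx
    obtain ⟨i, -, rfl⟩ := hx
    exact placeMask_lt Γ i
  exact ⟨hT', hplace p hp, hplace q hq.1⟩

/-- The corners of an engine face, twisted, are below `2 ^ n`. -/
theorem corners_twist_lt (Γ : CMGaloisType n) (f : ℕ × ℕ × ℕ) (j : Fin n) :
    ∀ x ∈ (Γ.corners f).map (Γ.twist j), x < 2 ^ n := by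
  intro x hx
  rw [List.mem_map] at hx
  obtain ⟨y, -, rfl⟩ := hx
  exact imageMask_lt _ _

/-! ### The model reading of `repsDistinct` -/

section Good

variable (Γ : CMGaloisType n) [Fact (Γ.isCMGaloisType = true)]

/-- **No double counting**: if `repsDistinct Γ reps = true` and every representative is a face of the engine, then the
corner multisets of two different representatives are not Galois twists of each other. -/
theorem cornersMul_ne_twistMul_of_repsDistinct (reps : List (ℕ × ℕ × ℕ)) (hd : repsDistinct Γ reps = true)
    (hf : ∀ r ∈ reps, r ∈ Γ.faces) {a b : ℕ} (ha : a < reps.length) (hb : b < reps.length) (hab : a ≠ b)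
    (g : Elt Γ) :
    cornersMul Γ (reps.getD a (0, 0, 0)) ≠ (cornersMul Γ (reps.getD b (0, 0, 0))).map fun S => rmul S g := by
  intro heq
  -- the engine-level inequality at `(a, b, idx g)`
  simp only [repsDistinct, List.all_eq_true, List.mem_finRange, true_implies] at hd
  have hd' := hd ⟨a, ha⟩ ⟨b, hb⟩
  rw [Bool.or_eq_true, beq_iff_eq] at hd'
  rcases hd' with hd' | hd'
  · exact hab (congrArg Fin.val hd')
  rw [List.all_eq_true] at hd'
  have hne := hd' (Elt.idx Γ g) (List.mem_finRange _)
  rw [bne_iff_ne] at hne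
  apply hne
  -- the representatives are faces, so their masks are below `2 ^ n`
  have hra : reps.getD a (0, 0, 0) ∈ reps := by
    rw [List.getD_eq_getElem?_getD, List.getElem?_eq_getElem ha]
    exact List.getElem_mem ha
  have hrb : reps.getD b (0, 0, 0) ∈ reps := by
    rw [List.getD_eq_getElem?_getD, List.getElem?_eq_getElem hb]
    exact List.getElem_mem hb
  obtain ⟨hT, hπ, hπ'⟩ := mem_faces_lt Γ (hf _ hra)
  -- the multiset equation as a permutation of corner lists (read through `finsetOf`)
  have e : (cornersMul Γ (reps.getD b (0, 0, 0))).map (fun S => rmul S (Elt.ofIdx Γ (Elt.idx Γ g))) =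
      ((((Γ.corners (reps.getD b (0, 0, 0))).map (Γ.twist (Elt.idx Γ g))).map (finsetOf Γ) :
        List (Finset (Elt Γ))) : Multiset (Finset (Elt Γ))) := by
    rw [cornersMul_twist, cornersMul, Multiset.map_coe]
  rw [Elt.ofIdx_idx] at e
  rw [e, cornersMul, Multiset.coe_eq_coe] at heq
  -- back to the masks
  have hperm := heq.map (maskOf Γ)
  rw [map_maskOf_map_finsetOf Γ (corners_lt Γ hT hπ hπ'),
    map_maskOf_map_finsetOf Γ (corners_twist_lt Γ _ _)] at hperm
  exact sortNat_eq_of_perm hperm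

end Good


/-! ### The eleven sealed rows -/

/-- Row `Sextic.Cyclic`: the sealed representatives are faces of the engine. -/
theorem reps_mem_faces_sexticCyclic : ∀ r ∈ Sextic.Cyclic.reps, r ∈ Sextic.Cyclic.Γ.faces := by decide +kernel

/-- **Row `Sextic.Cyclic`, no double counting**: the corner multisets of two different sealed representatives are not Galois
twists of each other (the group check from p4's census theorem). -/
theorem cornersMul_ne_twistMul_sexticCyclic {a b : ℕ} (ha : a < Sextic.Cyclic.reps.length) (hb : b < Sextic.Cyclic.reps.length)
    (hab : a ≠ b) (g : Elt Sextic.Cyclic.Γ) :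
    haveI : Fact (Sextic.Cyclic.Γ.isCMGaloisType = true) := ⟨Sextic.Cyclic.census.1⟩
    cornersMul Sextic.Cyclic.Γ (Sextic.Cyclic.reps.getD a (0, 0, 0)) ≠
      (cornersMul Sextic.Cyclic.Γ (Sextic.Cyclic.reps.getD b (0, 0, 0))).map fun S => rmul S g :=
  haveI : Fact (Sextic.Cyclic.Γ.isCMGaloisType = true) := ⟨Sextic.Cyclic.census.1⟩
  cornersMul_ne_twistMul_of_repsDistinct Sextic.Cyclic.Γ Sextic.Cyclic.reps repsDistinct_sexticCyclic reps_mem_faces_sexticCyclic ha hb hab g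

/-- Row `Octic.Cyclic`: the sealed representatives are faces of the engine. -/
theorem reps_mem_faces_octicCyclic : ∀ r ∈ Octic.Cyclic.reps, r ∈ Octic.Cyclic.Γ.faces := by decide +kernel

/-- **Row `Octic.Cyclic`, no double counting**: the corner multisets of two different sealed representatives are not Galois
twists of each other (the group check from p4's census theorem). -/
theorem cornersMul_ne_twistMul_octicCyclic {a b : ℕ} (ha : a < Octic.Cyclic.reps.length) (hb : b < Octic.Cyclic.reps.length)
    (hab : a ≠ b) (g : Elt Octic.Cyclic.Γ) :
    haveI : Fact (Octic.Cyclic.Γ.isCMGaloisType = true) := ⟨Octic.Cyclic.census.1⟩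
    cornersMul Octic.Cyclic.Γ (Octic.Cyclic.reps.getD a (0, 0, 0)) ≠
      (cornersMul Octic.Cyclic.Γ (Octic.Cyclic.reps.getD b (0, 0, 0))).map fun S => rmul S g :=
  haveI : Fact (Octic.Cyclic.Γ.isCMGaloisType = true) := ⟨Octic.Cyclic.census.1⟩
  cornersMul_ne_twistMul_of_repsDistinct Octic.Cyclic.Γ Octic.Cyclic.reps repsDistinct_octicCyclic reps_mem_faces_octicCyclic ha hb hab g

/-- Row `Octic.C4C2Square`: the sealed representatives are faces of the engine. -/
theorem reps_mem_faces_octicC4C2Square : ∀ r ∈ Octic.C4C2Square.reps, r ∈ Octic.C4C2Square.Γ.faces := by decide +kernel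

/-- **Row `Octic.C4C2Square`, no double counting**: the corner multisets of two different sealed representatives are not Galois
twists of each other (the group check from p4's census theorem). -/
theorem cornersMul_ne_twistMul_octicC4C2Square {a b : ℕ} (ha : a < Octic.C4C2Square.reps.length) (hb : b < Octic.C4C2Square.reps.length)
    (hab : a ≠ b) (g : Elt Octic.C4C2Square.Γ) :
    haveI : Fact (Octic.C4C2Square.Γ.isCMGaloisType = true) := ⟨Octic.C4C2Square.census.1⟩
    cornersMul Octic.C4C2Square.Γ (Octic.C4C2Square.reps.getD a (0, 0, 0)) ≠
      (cornersMul Octic.C4C2Square.Γ (Octic.C4C2Square.reps.getD b (0, 0, 0))).map fun S => rmul S g :=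
  haveI : Fact (Octic.C4C2Square.Γ.isCMGaloisType = true) := ⟨Octic.C4C2Square.census.1⟩
  cornersMul_ne_twistMul_of_repsDistinct Octic.C4C2Square.Γ Octic.C4C2Square.reps repsDistinct_octicC4C2Square reps_mem_faces_octicC4C2Square ha hb hab g

/-- Row `Octic.C4C2Nonsquare`: the sealed representatives are faces of the engine. -/
theorem reps_mem_faces_octicC4C2Nonsquare : ∀ r ∈ Octic.C4C2Nonsquare.reps, r ∈ Octic.C4C2Nonsquare.Γ.faces := by decide +kernel

/-- **Row `Octic.C4C2Nonsquare`, no double counting**: the corner multisets of two different sealed representatives are not Galois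
twists of each other (the group check from p4's census theorem). -/
theorem cornersMul_ne_twistMul_octicC4C2Nonsquare {a b : ℕ} (ha : a < Octic.C4C2Nonsquare.reps.length) (hb : b < Octic.C4C2Nonsquare.reps.length)
    (hab : a ≠ b) (g : Elt Octic.C4C2Nonsquare.Γ) :
    haveI : Fact (Octic.C4C2Nonsquare.Γ.isCMGaloisType = true) := ⟨Octic.C4C2Nonsquare.census.1⟩
    cornersMul Octic.C4C2Nonsquare.Γ (Octic.C4C2Nonsquare.reps.getD a (0, 0, 0)) ≠
      (cornersMul Octic.C4C2Nonsquare.Γ (Octic.C4C2Nonsquare.reps.getD b (0, 0, 0))).map fun S => rmul S g :=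
  haveI : Fact (Octic.C4C2Nonsquare.Γ.isCMGaloisType = true) := ⟨Octic.C4C2Nonsquare.census.1⟩
  cornersMul_ne_twistMul_of_repsDistinct Octic.C4C2Nonsquare.Γ Octic.C4C2Nonsquare.reps repsDistinct_octicC4C2Nonsquare reps_mem_faces_octicC4C2Nonsquare ha hb hab g

/-- Row `Octic.Triquadratic`: the sealed representatives are faces of the engine. -/
theorem reps_mem_faces_octicTriquadratic : ∀ r ∈ Octic.Triquadratic.reps, r ∈ Octic.Triquadratic.Γ.faces := by decide +kernel

/-- **Row `Octic.Triquadratic`, no double counting**: the corner multisets of two different sealed representatives are not Galois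
twists of each other (the group check from p4's census theorem). -/
theorem cornersMul_ne_twistMul_octicTriquadratic {a b : ℕ} (ha : a < Octic.Triquadratic.reps.length) (hb : b < Octic.Triquadratic.reps.length)
    (hab : a ≠ b) (g : Elt Octic.Triquadratic.Γ) :
    haveI : Fact (Octic.Triquadratic.Γ.isCMGaloisType = true) := ⟨Octic.Triquadratic.census.1⟩
    cornersMul Octic.Triquadratic.Γ (Octic.Triquadratic.reps.getD a (0, 0, 0)) ≠
      (cornersMul Octic.Triquadratic.Γ (Octic.Triquadratic.reps.getD b (0, 0, 0))).map fun S => rmul S g :=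
  haveI : Fact (Octic.Triquadratic.Γ.isCMGaloisType = true) := ⟨Octic.Triquadratic.census.1⟩
  cornersMul_ne_twistMul_of_repsDistinct Octic.Triquadratic.Γ Octic.Triquadratic.reps repsDistinct_octicTriquadratic reps_mem_faces_octicTriquadratic ha hb hab g

/-- Row `Octic.Dihedral`: the sealed representatives are faces of the engine. -/
theorem reps_mem_faces_octicDihedral : ∀ r ∈ Octic.Dihedral.reps, r ∈ Octic.Dihedral.Γ.faces := by decide +kernel

/-- **Row `Octic.Dihedral`, no double counting**: the corner multisets of two different sealed representatives are not Galois
twists of each other (the group check from p4's census theorem). -/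
theorem cornersMul_ne_twistMul_octicDihedral {a b : ℕ} (ha : a < Octic.Dihedral.reps.length) (hb : b < Octic.Dihedral.reps.length)
    (hab : a ≠ b) (g : Elt Octic.Dihedral.Γ) :
    haveI : Fact (Octic.Dihedral.Γ.isCMGaloisType = true) := ⟨Octic.Dihedral.census.1⟩
    cornersMul Octic.Dihedral.Γ (Octic.Dihedral.reps.getD a (0, 0, 0)) ≠
      (cornersMul Octic.Dihedral.Γ (Octic.Dihedral.reps.getD b (0, 0, 0))).map fun S => rmul S g :=
  haveI : Fact (Octic.Dihedral.Γ.isCMGaloisType = true) := ⟨Octic.Dihedral.census.1⟩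
  cornersMul_ne_twistMul_of_repsDistinct Octic.Dihedral.Γ Octic.Dihedral.reps repsDistinct_octicDihedral reps_mem_faces_octicDihedral ha hb hab g

/-- Row `Octic.Quaternion`: the sealed representatives are faces of the engine. -/
theorem reps_mem_faces_octicQuaternion : ∀ r ∈ Octic.Quaternion.reps, r ∈ Octic.Quaternion.Γ.faces := by decide +kernel

/-- **Row `Octic.Quaternion`, no double counting**: the corner multisets of two different sealed representatives are not Galois
twists of each other (the group check from p4's census theorem). -/
theorem cornersMul_ne_twistMul_octicQuaternion {a b : ℕ} (ha : a < Octic.Quaternion.reps.length) (hb : b < Octic.Quaternion.reps.length)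
    (hab : a ≠ b) (g : Elt Octic.Quaternion.Γ) :
    haveI : Fact (Octic.Quaternion.Γ.isCMGaloisType = true) := ⟨Octic.Quaternion.census.1⟩
    cornersMul Octic.Quaternion.Γ (Octic.Quaternion.reps.getD a (0, 0, 0)) ≠
      (cornersMul Octic.Quaternion.Γ (Octic.Quaternion.reps.getD b (0, 0, 0))).map fun S => rmul S g :=
  haveI : Fact (Octic.Quaternion.Γ.isCMGaloisType = true) := ⟨Octic.Quaternion.census.1⟩
  cornersMul_ne_twistMul_of_repsDistinct Octic.Quaternion.Γ Octic.Quaternion.reps repsDistinct_octicQuaternion reps_mem_faces_octicQuaternion ha hb hab g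

/-- Row `Duodecic.Cyclic`: the sealed representatives are faces of the engine. -/
theorem reps_mem_faces_duodecicCyclic : ∀ r ∈ Duodecic.Cyclic.reps, r ∈ Duodecic.Cyclic.Γ.faces := by decide +kernel

/-- **Row `Duodecic.Cyclic`, no double counting**: the corner multisets of two different sealed representatives are not Galois
twists of each other (the group check from p4's census theorem). -/
theorem cornersMul_ne_twistMul_duodecicCyclic {a b : ℕ} (ha : a < Duodecic.Cyclic.reps.length) (hb : b < Duodecic.Cyclic.reps.length)
    (hab : a ≠ b) (g : Elt Duodecic.Cyclic.Γ) :
    haveI : Fact (Duodecic.Cyclic.Γ.isCMGaloisType = true) := ⟨Duodecic.Cyclic.census.1⟩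
    cornersMul Duodecic.Cyclic.Γ (Duodecic.Cyclic.reps.getD a (0, 0, 0)) ≠
      (cornersMul Duodecic.Cyclic.Γ (Duodecic.Cyclic.reps.getD b (0, 0, 0))).map fun S => rmul S g :=
  haveI : Fact (Duodecic.Cyclic.Γ.isCMGaloisType = true) := ⟨Duodecic.Cyclic.census.1⟩
  cornersMul_ne_twistMul_of_repsDistinct Duodecic.Cyclic.Γ Duodecic.Cyclic.reps repsDistinct_duodecicCyclic reps_mem_faces_duodecicCyclic ha hb hab g

/-- Row `Duodecic.C6C2`: the sealed representatives are faces of the engine. -/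
theorem reps_mem_faces_duodecicC6C2 : ∀ r ∈ Duodecic.C6C2.reps, r ∈ Duodecic.C6C2.Γ.faces := by decide +kernel

/-- **Row `Duodecic.C6C2`, no double counting**: the corner multisets of two different sealed representatives are not Galois
twists of each other (the group check from p4's census theorem). -/
theorem cornersMul_ne_twistMul_duodecicC6C2 {a b : ℕ} (ha : a < Duodecic.C6C2.reps.length) (hb : b < Duodecic.C6C2.reps.length)
    (hab : a ≠ b) (g : Elt Duodecic.C6C2.Γ) :
    haveI : Fact (Duodecic.C6C2.Γ.isCMGaloisType = true) := ⟨Duodecic.C6C2.census.1⟩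
    cornersMul Duodecic.C6C2.Γ (Duodecic.C6C2.reps.getD a (0, 0, 0)) ≠
      (cornersMul Duodecic.C6C2.Γ (Duodecic.C6C2.reps.getD b (0, 0, 0))).map fun S => rmul S g :=
  haveI : Fact (Duodecic.C6C2.Γ.isCMGaloisType = true) := ⟨Duodecic.C6C2.census.1⟩
  cornersMul_ne_twistMul_of_repsDistinct Duodecic.C6C2.Γ Duodecic.C6C2.reps repsDistinct_duodecicC6C2 reps_mem_faces_duodecicC6C2 ha hb hab g

/-- Row `Duodecic.Dihedral`: the sealed representatives are faces of the engine. -/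
theorem reps_mem_faces_duodecicDihedral : ∀ r ∈ Duodecic.Dihedral.reps, r ∈ Duodecic.Dihedral.Γ.faces := by decide +kernel

/-- **Row `Duodecic.Dihedral`, no double counting**: the corner multisets of two different sealed representatives are not Galois
twists of each other (the group check from p4's census theorem). -/
theorem cornersMul_ne_twistMul_duodecicDihedral {a b : ℕ} (ha : a < Duodecic.Dihedral.reps.length) (hb : b < Duodecic.Dihedral.reps.length)
    (hab : a ≠ b) (g : Elt Duodecic.Dihedral.Γ) :
    haveI : Fact (Duodecic.Dihedral.Γ.isCMGaloisType = true) := ⟨Duodecic.Dihedral.census.1⟩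
    cornersMul Duodecic.Dihedral.Γ (Duodecic.Dihedral.reps.getD a (0, 0, 0)) ≠
      (cornersMul Duodecic.Dihedral.Γ (Duodecic.Dihedral.reps.getD b (0, 0, 0))).map fun S => rmul S g :=
  haveI : Fact (Duodecic.Dihedral.Γ.isCMGaloisType = true) := ⟨Duodecic.Dihedral.census.1⟩
  cornersMul_ne_twistMul_of_repsDistinct Duodecic.Dihedral.Γ Duodecic.Dihedral.reps repsDistinct_duodecicDihedral reps_mem_faces_duodecicDihedral ha hb hab g

/-- Row `Duodecic.Dicyclic`: the sealed representatives are faces of the engine. -/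
theorem reps_mem_faces_duodecicDicyclic : ∀ r ∈ Duodecic.Dicyclic.reps, r ∈ Duodecic.Dicyclic.Γ.faces := by decide +kernel

/-- **Row `Duodecic.Dicyclic`, no double counting**: the corner multisets of two different sealed representatives are not Galois
twists of each other (the group check from p4's census theorem). -/
theorem cornersMul_ne_twistMul_duodecicDicyclic {a b : ℕ} (ha : a < Duodecic.Dicyclic.reps.length) (hb : b < Duodecic.Dicyclic.reps.length)
    (hab : a ≠ b) (g : Elt Duodecic.Dicyclic.Γ) :
    haveI : Fact (Duodecic.Dicyclic.Γ.isCMGaloisType = true) := ⟨Duodecic.Dicyclic.census.1⟩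
    cornersMul Duodecic.Dicyclic.Γ (Duodecic.Dicyclic.reps.getD a (0, 0, 0)) ≠
      (cornersMul Duodecic.Dicyclic.Γ (Duodecic.Dicyclic.reps.getD b (0, 0, 0))).map fun S => rmul S g :=
  haveI : Fact (Duodecic.Dicyclic.Γ.isCMGaloisType = true) := ⟨Duodecic.Dicyclic.census.1⟩
  cornersMul_ne_twistMul_of_repsDistinct Duodecic.Dicyclic.Γ Duodecic.Dicyclic.reps repsDistinct_duodecicDicyclic reps_mem_faces_duodecicDicyclic ha hb hab g

end HodgeRepro.Night3.Census
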